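import Mathlib
import Summits.ResolutionOfSingularities.ResolutionOfSingularities.Theorems.PAlterationPicoverGoodRepresentative
import Summits.ResolutionOfSingularities.ResolutionOfSingularities.Theorems.PAlterationPicoverGoodRepresentativeConverse
import Literature.AlgebraicGeometry.Resolution.KummerNormalForm
import HarnessLib

set_option linter.dupNamespace false -- mandated namespace of this single-conjunct summit

/-!
# Regularity of the degree-`p` radicial cover ⟺ a boundary-free Giraud normal form

Crux `Picover` (stmt-ResolutionOfSingularities-0554), line `giraud-separated-base`, stub
`isRegularRing_iff_exists_giraudNormalFormAt_zero` — the bridge between the two lines of the crux.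

**Setting.** `(R, 𝔪)` regular local of prime characteristic `p`; `S` a normal domain, finite over
`R` of generic rank `p` with `R ↪ S` and `S^p ⊆ R` (radicial).  **Claim.** `S` is a regular ring
iff some representative `h = s^p ∈ R` (`s ∈ S ∖ R`) is in Giraud normal form with respect to the
EMPTY boundary (`r = 0`, `x = Fin.elim0`).

**Proof.** With no boundary equations the Kummer/toric alternative of `GiraudNormalFormAt` is void
(`∃ j : Fin 0` is false) and the first alternative reads `h = g^p + u` with `u`
wound-or-transversal, i.e. either `u - c^p ∉ 𝔪` for all `c` or `u - c₀^p ∈ 𝔪 ∖ 𝔪²` for some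
`c₀`.  Either way `u - c^p ∉ 𝔪²` for EVERY `c` (in the transversal case, `u - c^p ∈ 𝔪²` would
give `(c - c₀)^p = c^p - c₀^p ∈ 𝔪`, so `c - c₀ ∈ 𝔪`, so `c^p - c₀^p ∈ 𝔪^p ⊆ 𝔪²` and then
`u - c₀^p ∈ 𝔪²`), hence `h - c^p = u - (c - g)^p ∉ 𝔪²` for every `c`: `h` is a *good
representative* and `S` is regular by `isRegularRing_of_exists_good_representative`.  Conversely
a good representative `h` (which exists when `S` is regular, by
`exists_good_representative_of_isRegularRing_of_radicial`) is in Giraud normal form with `g = 0`,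
`u = h`.  No statement item is restated; all helpers are private.
-/

universe u

namespace Summit.ResolutionOfSingularities.ResolutionOfSingularities.Theorems.Picover.RegularIffNormalFormZero

open IsLocalRing Literature.AlgebraicGeometry.Resolution

/-- In a local ring of prime characteristic `p`: if `u - c₀^p ∈ 𝔪 ∖ 𝔪²` for some `c₀`, then
`u - c^p ∉ 𝔪²` for every `c` (Frobenius: `c^p - c₀^p = (c - c₀)^p`, and `𝔪` is prime). -/
private theorem not_mem_sq_of_transversal {p : ℕ} [Fact p.Prime] {R : Type*} [CommRing R]
    [IsLocalRing R] [CharP R p] {u c₀ : R} (h₁ : u - c₀ ^ p ∈ maximalIdeal R)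
    (h₂ : u - c₀ ^ p ∉ maximalIdeal R ^ 2) (c : R) : u - c ^ p ∉ maximalIdeal R ^ 2 := by
  intro hc
  have hp : p.Prime := Fact.out
  apply h₂
  have e1 : c ^ p - c₀ ^ p ∈ maximalIdeal R := by
    have := (maximalIdeal R).sub_mem h₁ (Ideal.pow_le_self two_ne_zero hc)
    rwa [sub_sub_sub_cancel_left] at this
  have e2 : c - c₀ ∈ maximalIdeal R := by
    rw [← sub_pow_char] at e1
    exact (inferInstance : (maximalIdeal R).IsPrime).mem_of_pow_mem p e1
  have e3 : c ^ p - c₀ ^ p ∈ maximalIdeal R ^ 2 := by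
    rw [← sub_pow_char]
    exact Ideal.pow_le_pow_right hp.two_le (Ideal.pow_mem_pow e2 p)
  have := Ideal.add_mem _ hc e3
  rwa [sub_add_sub_cancel] at this

/-- With empty boundary, a wound-or-transversal `u` satisfies `u - c^p ∉ 𝔪²` for every `c`. -/
private theorem not_mem_sq_of_isWoundOrTransversalAt {p : ℕ} [Fact p.Prime] {R : Type*}
    [CommRing R] [IsLocalRing R] [CharP R p] {u : R}
    (hu : IsWoundOrTransversalAt p (Fin.elim0 : Fin 0 → R) u) (c : R) :
    u - c ^ p ∉ maximalIdeal R ^ 2 := by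
  rcases hu with hw | ⟨c₀, hc₀, hnot⟩
  · exact fun hc => hw c (Ideal.pow_le_self two_ne_zero hc)
  · have hspan : Ideal.span (Set.range (Fin.elim0 : Fin 0 → R)) = ⊥ := by
      rw [Set.range_eq_empty, Ideal.span_empty]
    rw [hspan, sup_bot_eq] at hnot
    exact not_mem_sq_of_transversal hc₀ hnot c

/-- With empty boundary, a good representative (`h - c^p ∉ 𝔪²` for all `c`) is
wound-or-transversal. -/
private theorem isWoundOrTransversalAt_of_good {p : ℕ} {R : Type*} [CommRing R] [IsLocalRing R]
    {h : R} (hgood : ∀ c : R, h - c ^ p ∉ maximalIdeal R ^ 2) :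
    IsWoundOrTransversalAt p (Fin.elim0 : Fin 0 → R) h := by
  by_cases hc : ∃ c : R, h - c ^ p ∈ maximalIdeal R
  · obtain ⟨c, hc⟩ := hc
    refine Or.inr ⟨c, hc, ?_⟩
    have hspan : Ideal.span (Set.range (Fin.elim0 : Fin 0 → R)) = ⊥ := by
      rw [Set.range_eq_empty, Ideal.span_empty]
    rw [hspan, sup_bot_eq]
    exact hgood c
  · push Not at hc
    exact Or.inl hc

/-- **Regular ⟺ boundary-free Giraud normal form.**  Let `(R, 𝔪)` be a regular local ring of
prime characteristic `p` and `S` a normal domain, finite over `R` of rank `p`, with `R ↪ S` and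
`S^p ⊆ R`.  Then `S` is a regular ring iff some `h ∈ R` with a `p`-th root `s ∈ S ∖ R` is in
Giraud normal form with respect to the empty family of boundary equations — which unfolds to the
good-representative condition `∀ c, h - c^p ∉ 𝔪²` of the forcing criterion
(`isRegularRing_of_exists_good_representative` /
`exists_good_representative_of_isRegularRing_of_radicial`). -/
theorem isRegularRing_iff_exists_giraudNormalFormAt_zero : ∀ {p : ℕ} [Fact p.Prime] {R : Type u} [CommRing R] [IsRegularLocalRing R] [CharP R p] {S : Type u} [CommRing S] [IsDomain S] [Algebra R S] [Module.Finite R S] [FaithfulSMul R S] [IsIntegrallyClosed S], Module.finrank R S = p → (∀ s : S, s ^ p ∈ (algebraMap R S).range) → (IsRegularRing S ↔ ∃ (h : R) (s : S), s ^ p = algebraMap R S h ∧ s ∉ (algebraMap R S).range ∧ GiraudNormalFormAt p (Fin.elim0 : Fin 0 → R) h) := by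
  intro p _ R _ _ _ S _ _ _ _ _ _ hrank hrad
  have hp : p.Prime := Fact.out
  constructor
  · intro hreg
    obtain ⟨h, s, hs, hns, hgood⟩ :=
      GoodRepresentativeConverse.exists_good_representative_of_isRegularRing_of_radicial
        hrank hrad hreg
    refine ⟨h, s, hs, hns, Or.inl ⟨0, h, Fin.elim0, isWoundOrTransversalAt_of_good hgood, ?_⟩⟩
    simp [zero_pow hp.ne_zero]
  · rintro ⟨h, s, hs, hns, ⟨g, u, B, hwt, hh⟩ | ⟨g, A, v, ⟨j, _⟩, _⟩⟩
    · have hh' : h = g ^ p + u := by simpa using hh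
      refine GoodRepresentative.isRegularRing_of_exists_good_representative hrank h s hs hns ?_
      intro c
      have e : h - c ^ p = u - (c - g) ^ p := by rw [sub_pow_char, hh']; ring
      rw [e]
      exact not_mem_sq_of_isWoundOrTransversalAt hwt (c - g)
    · exact j.elim0

/-- **Derivation criterion** (the classical differential form of the good-representative test).
In the setting of `isRegularRing_iff_exists_giraudNormalFormAt_zero` (without the radicial
hypothesis): if some derivation `D` of `R` takes `h` to a unit and `h` has a `p`-th root `s ∈ S`,
then `S` is regular.  Indeed `D` maps `𝔪²` into `𝔪` and kills `p`-th powers in characteristic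
`p`, so `h - c^p ∈ 𝔪²` would put `D h ∈ 𝔪`; and `s ∉ R` since otherwise `h = r^p` and
`D h = 0`. -/
theorem isRegularRing_of_derivation_isUnit {p : ℕ} [Fact p.Prime] {R : Type u} [CommRing R]
    [IsRegularLocalRing R] [CharP R p] {S : Type u} [CommRing S] [IsDomain S] [Algebra R S]
    [Module.Finite R S] [FaithfulSMul R S] [IsIntegrallyClosed S] (hrank : Module.finrank R S = p)
    (D : Derivation ℤ R R) {h : R} {s : S} (hD : IsUnit (D h)) (hs : s ^ p = algebraMap R S h) :
    IsRegularRing S := by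
  have hwt : IsWoundOrTransversalAt p (Fin.elim0 : Fin 0 → R) h :=
    isWoundOrTransversalAt_of_derivation p Fin.elim0 (fun j => j.elim0) h D (fun j => j.elim0) hD
  refine GoodRepresentative.isRegularRing_of_exists_good_representative hrank h s hs ?_
    (not_mem_sq_of_isWoundOrTransversalAt hwt)
  rintro ⟨r, rfl⟩
  rw [← map_pow] at hs
  have hr : r ^ p = h := FaithfulSMul.algebraMap_injective R S hs
  have hDh : D h = 0 := by
    rw [← hr, Derivation.leibniz_pow, nsmul_eq_mul, CharP.cast_eq_zero R p, zero_mul]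
  exact not_isUnit_zero (hDh ▸ hD)

end Summit.ResolutionOfSingularities.ResolutionOfSingularities.Theorems.Picover.RegularIffNormalFormZero
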